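import Summits.AtomisticToContinuum.HydrodynamicLimit.Theorems.InformationPercolationEngineCollisionRateCoreEquivalence
import HarnessLib

/-!
# `InformationPercolationEngine.CollisionRate` (stmt-AtomisticToContinuum-13481): the line's chassis RE-THREADED IN THE PRE-SHOCK,
# DATA-TIED FRAME — helper file PSF of the crux line `Sketch`

Helper file (`--supports stmt-AtomisticToContinuum-13481`) of the crux line `Sketch` (lead c10 = prover-line-stmt-AtomisticToContinuum-
13481-c10-0, skeleton `Cruxes/CollisionRate/Lines/Sketch.lean` v27).  The line reduced the crux (the Enskog collision-frequency law for the
deterministic hard-sphere flow at fixed reduced diameter `σ`, claimed for EVERY horizon `τ > 0`) to `(A) ∧ T34p` and proved the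
characterisation `(A) → (CollisionRate ↔ T34p)` (RED′ `…CollisionRateReductionProb.lean`, NEC `…CollisionRateCoreNecessity.lean`, EQV
`…CollisionRateCoreEquivalence.lean`), all in the FILED frame `∀ τ > 0`.  The crux's only consumer, the kinetic dock
`InformationPercolationEngine.ChaosClosesEuler`, uses it under the hypotheses of the sub-problem conjunct — a classical hard-sphere Euler
solution `IsHardSphereEulerSolution σ T ρ u θ` on `[0, T)` whose packing stays below the threshold, the `t = 0` law of large numbers
`TendstoHydroFieldsAt … 0`, horizons `τ < T` — and the standing recommendation of the crux's disprover (`Cruxes/CollisionRate/Disproof.lean`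
§3(4b)), of three prover audits (A6) and of the crux strategist (`Cruxes/CollisionRate/STRATEGY-CENSUS.md`, R1; typed restatement
`Cruxes/CollisionRate/StrategistSketch.lean` §4 `CollisionRatePreShock`, with `CollisionRate → CollisionRatePreShock` proved there) is to
RESTATE the crux in that tied frame, which removes the post-shock `∀ τ` surplus (sub-`r` two-stream texture) at zero cost to `closes`.

This file makes the restatement inherit the line's chassis: the two directions of the characterisation are re-threaded with the tied
binders `T ρ θ u, IsHardSphereEulerSolution σ T ρ u θ, (∀ t ∈ Ico 0 T, ∀ x, ρ t x * σ ^ 3 < η₀), TendstoHydroFieldsAt … 0, τ < T`: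

* `stub_evenStatOnePreShock_of_evenTubeTimeStatProbPreShock` — **RED′-ps: `(A) → T34p-ps → ESO-ps`**;
* `stub_evenTubeTimeStatProbPreShock_of_evenStatOnePreShock` — **NEC-ps: `(A) → ESO-ps → T34p-ps`**.

Here ESO-ps is VERBATIM the body of the strategist's `CollisionRatePreShock` (the crux statistic in its `evenStat`-at-mark-`1` form, cf. the
bridge `collisionRate_iff_evenStat_one`), T34p-ps is the kinetic core T34p (time-integrated Boltzmann collision cylinder at the
speed-truncated unit mark `Ξ₁ᴸ` and flight-time resolution `κε`, minus `σ³ ×` Enskog's prediction from the same configurations' `r`-ball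
fields, small in `LG`-probability) with the same tied prefix, and (A) is the marginal envelope of the evolved local Gibbs law exactly as in
the sibling files (frame-free; implied by the existing item `BGEndpointRigidity.LanfordEnvelopeR`, stmt-13677, bridge BR).  The proofs are
those of RED′ / NEC verbatim with the tied binders threaded: the landed links T1 `stub_unitMarkTruncation`, T2
`stub_cylinderPullbackUnit_of_residuals` ∘ (T2a, T2b′ ∘ (F2, F3), T2c′) and `CollisionMomentBound ⇐ F2` hold for every `τ` and are merely
instantiated; only the third summand carries the frame, and its packing guard at the composite threshold `min (min η₁ η₂) η₃` implies the
guard at `η₃`.  No new definitions; no dynamics is proved; both tied statements remain OPEN at `t > 0` (Boltzmann–Enskog class), exactly as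
their untied forms — the tied frame changes WHAT IS CLAIMED post-shock, not the difficulty pre-shock.

References: H. van Beijeren, M. H. Ernst, Physica 68 (1973) 437; P. Résibois, J. Stat. Phys. 19 (1978) 593; H. Spohn, *Large Scale
Dynamics of Interacting Particles* (1991), Part I §2.4, §3; C. Cercignani, R. Illner, M. Pulvirenti, *The Mathematical Theory of Dilute
Gases* (1994), §4.3.
-/

open scoped BigOperators Topology Classical MeasureTheory ProbabilityTheory InnerProductSpace ENNReal
open Filter Set Function MeasureTheory
open Literature.Analysis.FluidPDE Literature.MathematicalPhysics.KineticTheory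

namespace Summit.AtomisticToContinuum.HydrodynamicLimit.Theorems.CollisionRate

open Summit.AtomisticToContinuum.HydrodynamicLimit.Theses.InformationPercolationEngine

noncomputable section

/-- **RED′-ps: `(A) → T34p-ps → ESO-ps` — the reduction in the pre-shock, data-tied frame.**  Under the marginal envelope (A) of the
evolved local Gibbs law, the TIED kinetic core T34p-ps (for classical hard-sphere Euler solutions on `[0,T)` with packing below the
threshold and local Gibbs data satisfying the `t = 0` LLN, for horizons `τ < T`: the time-integrated even tube statistic
`evenTubeTimeStat σ N (Φ N) τ χ g Ξ₁ᴸ r κ` is small in `LG`-probability) implies the TIED crux statistic ESO-ps (`evenStat σ N (Φ N) τ χ g 1 r`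
small in `LG`-probability, same frame — verbatim the strategist's `CollisionRatePreShock`).  Proof = RED′
`stub_evenStatOne_of_evenTubeTimeStatProb` with the tied binders threaded; union bound, accuracies `(η/3, δ/3)`, level
`L := max (max L₀ L₃) 1`, window `κ := min (κ₂/2) (κ₃/2)`. [folklore] -/
theorem stub_evenStatOnePreShock_of_evenTubeTimeStatProbPreShock :
    (∀ (a₀ θ₀ : T3 → ℝ) (u₀ : T3 → V3), Continuous a₀ → Continuous θ₀ → Continuous u₀ →
      (∀ x, 0 < a₀ x) → (∀ x, 0 < θ₀ x) → ∃ σ₀ : ℝ, 0 < σ₀ ∧ ∀ σ : ℝ, 0 < σ → σ < σ₀ →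
      ∀ Φ : (N : ℕ) → HardSphereFlow (Torus.geometry (Fin 3)) (hsDiameter σ N) (N + 1),
      ∀ τ : ℝ, 0 < τ → ∃ C : ℝ, 0 ≤ C ∧ ∃ u : V3, ∃ θ : ℝ, 0 < θ ∧ ∃ N₀ : ℕ, ∀ N : ℕ, N₀ ≤ N →
      ∀ t ∈ Set.Icc (0 : ℝ) τ,
        (∀ i j : Fin (N + 1), i ≠ j → ∀ f : (T3 × V3) × (T3 × V3) → ℝ≥0∞, Measurable f →
          ∫⁻ z, f ((Φ N).flow t z i, (Φ N).flow t z j) ∂(localGibbsLaw σ a₀ u₀ θ₀ N (Φ N)) ≤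
            ENNReal.ofReal C * ∫⁻ q, f q ∂(((volume : Measure T3).prod (gaussMeasure u θ)).prod
              ((volume : Measure T3).prod (gaussMeasure u θ)))) ∧
        (∀ i j k : Fin (N + 1), i ≠ j → i ≠ k → j ≠ k → ∀ f : (T3 × V3) × (T3 × V3) × (T3 × V3) → ℝ≥0∞, Measurable f →
          ∫⁻ z, f ((Φ N).flow t z i, (Φ N).flow t z j, (Φ N).flow t z k) ∂(localGibbsLaw σ a₀ u₀ θ₀ N (Φ N)) ≤
            ENNReal.ofReal C * ∫⁻ q, f q ∂(((volume : Measure T3).prod (gaussMeasure u θ)).prod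
              (((volume : Measure T3).prod (gaussMeasure u θ)).prod ((volume : Measure T3).prod (gaussMeasure u θ)))))) →
    (∃ η₀ : ℝ, 0 < η₀ ∧ ∀ (a₀ θ₀ : T3 → ℝ) (u₀ : T3 → V3), Continuous a₀ → Continuous θ₀ → Continuous u₀ →
      (∀ x, 0 < a₀ x) → (∀ x, 0 < θ₀ x) → ∃ σ₀ : ℝ, 0 < σ₀ ∧ ∀ σ : ℝ, 0 < σ → σ < σ₀ →
      ∀ (T : ℝ) (ρ θ : ℝ → T3 → ℝ) (u : ℝ → T3 → V3), IsHardSphereEulerSolution σ T ρ u θ →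
      (∀ t ∈ Set.Ico 0 T, ∀ x, ρ t x * σ ^ 3 < η₀) →
      ∀ Φ : (N : ℕ) → HardSphereFlow (Torus.geometry (Fin 3)) (hsDiameter σ N) (N + 1),
      TendstoHydroFieldsAt (fun N => localGibbsLaw σ a₀ u₀ θ₀ N (Φ N)) Φ ρ u θ 0 →
      ∀ τ : ℝ, 0 < τ → τ < T → ∀ χ : ℝ × T3 → ℝ, Continuous χ → ∀ g : ℝ → ℝ, Continuous g →
      (∀ x, η₀ ≤ x → g x = 0) →
      ∀ η δ : ℝ, 0 < η → 0 < δ → ∃ r₀ : ℝ, 0 < r₀ ∧ ∀ r : ℝ, 0 < r → r < r₀ →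
      ∃ L₀ : ℝ, ∀ L : ℝ, L₀ ≤ L → ∃ κ₀ : ℝ, 0 < κ₀ ∧ ∀ κ : ℝ, 0 < κ → κ < κ₀ → ∃ N₀ : ℕ, ∀ N : ℕ, N₀ ≤ N →
        localGibbsLaw σ a₀ u₀ θ₀ N (Φ N)
          {z | η < |evenTubeTimeStat σ N (Φ N) τ χ g (fun q : V3 × V3 × V3 => speedCutoff L ‖q.2.2 - q.2.1‖) r κ z|}
          ≤ ENNReal.ofReal δ) →
    ∃ η₀ : ℝ, 0 < η₀ ∧ ∀ (a₀ θ₀ : T3 → ℝ) (u₀ : T3 → V3), Continuous a₀ → Continuous θ₀ → Continuous u₀ →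
      (∀ x, 0 < a₀ x) → (∀ x, 0 < θ₀ x) → ∃ σ₀ : ℝ, 0 < σ₀ ∧ ∀ σ : ℝ, 0 < σ → σ < σ₀ →
      ∀ (T : ℝ) (ρ θ : ℝ → T3 → ℝ) (u : ℝ → T3 → V3), IsHardSphereEulerSolution σ T ρ u θ →
      (∀ t ∈ Set.Ico 0 T, ∀ x, ρ t x * σ ^ 3 < η₀) →
      ∀ Φ : (N : ℕ) → HardSphereFlow (Torus.geometry (Fin 3)) (hsDiameter σ N) (N + 1),
      TendstoHydroFieldsAt (fun N => localGibbsLaw σ a₀ u₀ θ₀ N (Φ N)) Φ ρ u θ 0 →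
      ∀ τ : ℝ, 0 < τ → τ < T → ∀ χ : ℝ × T3 → ℝ, Continuous χ → ∀ g : ℝ → ℝ, Continuous g →
      (∀ a, η₀ ≤ a → g a = 0) →
      ∀ η δ : ℝ, 0 < η → 0 < δ → ∃ r₀ : ℝ, 0 < r₀ ∧ ∀ r : ℝ, 0 < r → r < r₀ →
      ∃ N₀ : ℕ, ∀ N : ℕ, N₀ ≤ N →
        localGibbsLaw σ a₀ u₀ θ₀ N (Φ N) {z | η < |evenStat σ N (Φ N) τ χ g (fun _ => 1) r z|}
          ≤ ENNReal.ofReal δ := by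
  -- adapted from `stub_evenStatOne_of_evenTubeTimeStatProb` (RED′): the same chain, the tied binders threaded to the third summand
  intro hA hT34p
  -- the landed links of the chain (frame-free: they hold for every horizon)
  have hF2 := stub_collisionMarkFluxLG_of_envelope hA
  have hF3 := stub_fwdHitFluxLG_of_envelope hA
  have hCMB : CollisionMomentBound :=
    Summit.AtomisticToContinuum.HydrodynamicLimit.Theorems.CollisionMomentBound.collisionMomentBound_of_collisionMarkFlux hF2
  have hT2b := stub_shortFlightDeficitLG_of_flux hF2 hF3
  have hT2 := stub_cylinderPullbackUnit_of_residuals (stub_continuityCorrectionLG hCMB hT2b) hT2b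
    (stub_threeBodyCollisionSumLG_of_envelope hA)
  obtain ⟨η₁, hη₁, H1⟩ := stub_unitMarkTruncation hCMB
  obtain ⟨η₂, hη₂, H2⟩ := hT2
  obtain ⟨η₃, hη₃, H3⟩ := hT34p
  refine ⟨min (min η₁ η₂) η₃, lt_min (lt_min hη₁ hη₂) hη₃, ?_⟩
  intro a₀ θ₀ u₀ ha hθ hu ha0 hθ0
  obtain ⟨σ₁, hσ₁, H1⟩ := H1 a₀ θ₀ u₀ ha hθ hu ha0 hθ0
  obtain ⟨σ₂, hσ₂, H2⟩ := H2 a₀ θ₀ u₀ ha hθ hu ha0 hθ0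
  obtain ⟨σ₃, hσ₃, H3⟩ := H3 a₀ θ₀ u₀ ha hθ hu ha0 hθ0
  refine ⟨min (min σ₁ σ₂) σ₃, lt_min (lt_min hσ₁ hσ₂) hσ₃, ?_⟩
  intro σ hσ hσlt T ρ θ u hEul hguard Φ hLLN τ hτ hτT χ hχ g hg hg0 η δ hη hδ
  have hσ1 : σ < σ₁ := lt_of_lt_of_le hσlt ((min_le_left _ _).trans (min_le_left _ _))
  have hσ2 : σ < σ₂ := lt_of_lt_of_le hσlt ((min_le_left _ _).trans (min_le_right _ _))
  have hσ3 : σ < σ₃ := lt_of_lt_of_le hσlt (min_le_right _ _)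
  -- the cutoff vanishes above each threshold
  have hg1 : ∀ x, η₁ ≤ x → g x = 0 := fun x h => hg0 x (((min_le_left _ _).trans (min_le_left _ _)).trans h)
  have hg2 : ∀ x, η₂ ≤ x → g x = 0 := fun x h => hg0 x (((min_le_left _ _).trans (min_le_right _ _)).trans h)
  have hg3 : ∀ x, η₃ ≤ x → g x = 0 := fun x h => hg0 x ((min_le_right _ _).trans h)
  -- the packing guard at the composite threshold implies the guard at `η₃`
  have hguard3 : ∀ t ∈ Set.Ico 0 T, ∀ x, ρ t x * σ ^ 3 < η₃ :=
    fun t ht x => lt_of_lt_of_le (hguard t ht x) (min_le_right _ _)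
  -- accuracies
  have hη3 : 0 < η / 3 := by positivity
  have hδ3 : 0 < δ / 3 := by positivity
  obtain ⟨r₁, hr₁, H1⟩ := H1 σ hσ hσ1 Φ τ hτ χ hχ g hg hg1 (η / 3) (δ / 3) hη3 hδ3
  obtain ⟨r₂, hr₂, H2⟩ := H2 σ hσ hσ2 Φ τ hτ χ hχ g hg hg2 (η / 3) (δ / 3) hη3 hδ3
  obtain ⟨r₃, hr₃, H3⟩ :=
    H3 σ hσ hσ3 T ρ θ u hEul hguard3 Φ hLLN τ hτ hτT χ hχ g hg hg3 (η / 3) (δ / 3) hη3 hδ3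
  refine ⟨min (min r₁ r₂) r₃, lt_min (lt_min hr₁ hr₂) hr₃, ?_⟩
  intro r hr hrlt
  have hr1 : r < r₁ := lt_of_lt_of_le hrlt ((min_le_left _ _).trans (min_le_left _ _))
  have hr2 : r < r₂ := lt_of_lt_of_le hrlt ((min_le_left _ _).trans (min_le_right _ _))
  have hr3 : r < r₃ := lt_of_lt_of_le hrlt (min_le_right _ _)
  -- truncation level: T1 needs `L₀ ≤ L`, T34p-ps needs `L₃ ≤ L`, T2 needs `1 ≤ L`
  obtain ⟨L₀, H1⟩ := H1 r hr hr1
  obtain ⟨L₃, H3⟩ := H3 r hr hr3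
  have hL₀ : L₀ ≤ max (max L₀ L₃) 1 := (le_max_left _ _).trans (le_max_left _ _)
  have hL3 : L₃ ≤ max (max L₀ L₃) 1 := (le_max_right _ _).trans (le_max_left _ _)
  have hL1 : (1 : ℝ) ≤ max (max L₀ L₃) 1 := le_max_right _ _
  obtain ⟨N₁, H1⟩ := H1 (max (max L₀ L₃) 1) hL₀
  -- flight-time window (T2 and T34p-ps each give a κ₀)
  obtain ⟨κ₂, hκ₂, H2⟩ := H2 r hr hr2 (max (max L₀ L₃) 1) hL1
  obtain ⟨κ₃, hκ₃, H3⟩ := H3 (max (max L₀ L₃) 1) hL3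
  have hκpos : (0 : ℝ) < min (κ₂ / 2) (κ₃ / 2) := lt_min (by positivity) (by positivity)
  have hκlt2 : min (κ₂ / 2) (κ₃ / 2) < κ₂ := lt_of_le_of_lt (min_le_left _ _) (by linarith)
  have hκlt3 : min (κ₂ / 2) (κ₃ / 2) < κ₃ := lt_of_le_of_lt (min_le_right _ _) (by linarith)
  obtain ⟨N₂, H2⟩ := H2 (min (κ₂ / 2) (κ₃ / 2)) hκpos hκlt2
  obtain ⟨N₃, H3⟩ := H3 (min (κ₂ / 2) (κ₃ / 2)) hκpos hκlt3
  refine ⟨max N₁ (max N₂ N₃), fun N hN => ?_⟩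
  have hN1 : N₁ ≤ N := (le_max_left _ _).trans hN
  have hN2 : N₂ ≤ N := ((le_max_left _ _).trans (le_max_right _ _)).trans hN
  have hN3 : N₃ ≤ N := ((le_max_right _ _).trans (le_max_right _ _)).trans hN
  have E1 := H1 N hN1
  have E2 := H2 N hN2
  have E3 := H3 N hN3
  -- the union bound
  set P := localGibbsLaw σ a₀ u₀ θ₀ N (Φ N) with hP
  set D := fun z => evenStat σ N (Φ N) τ χ g (fun _ => 1) r z with hD
  set DL := fun z => evenStat σ N (Φ N) τ χ g
    (fun q : V3 × V3 × V3 => speedCutoff (max (max L₀ L₃) 1) ‖q.2.2 - q.2.1‖) r z with hDL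
  set T' := fun z => evenTubeTimeStat σ N (Φ N) τ χ g
    (fun q : V3 × V3 × V3 => speedCutoff (max (max L₀ L₃) 1) ‖q.2.2 - q.2.1‖) r (min (κ₂ / 2) (κ₃ / 2)) z with hT'
  have E3' : P {z | η / 3 < |T' z|} ≤ ENNReal.ofReal (δ / 3) := E3
  have hsub : {z | η < |D z|} ⊆
      ({z | η / 3 < |D z - DL z|} ∪ {z | η / 3 < |DL z - T' z|}) ∪ {z | η / 3 < |T' z|} := by
    intro z hz
    simp only [Set.mem_setOf_eq, Set.mem_union] at hz ⊢
    by_contra hcon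
    simp only [not_or, not_lt] at hcon
    obtain ⟨⟨h1, h2⟩, h3⟩ := hcon
    have i1 := abs_sub_abs_le_abs_sub (D z) (DL z)
    have i2 := abs_sub_abs_le_abs_sub (DL z) (T' z)
    linarith
  calc P {z | η < |D z|}
      ≤ P (({z | η / 3 < |D z - DL z|} ∪ {z | η / 3 < |DL z - T' z|}) ∪ {z | η / 3 < |T' z|}) :=
        measure_mono hsub
    _ ≤ P ({z | η / 3 < |D z - DL z|} ∪ {z | η / 3 < |DL z - T' z|}) + P {z | η / 3 < |T' z|} :=
        measure_union_le _ _
    _ ≤ (P {z | η / 3 < |D z - DL z|} + P {z | η / 3 < |DL z - T' z|}) + P {z | η / 3 < |T' z|} :=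
        add_le_add (measure_union_le _ _) le_rfl
    _ ≤ (ENNReal.ofReal (δ / 3) + ENNReal.ofReal (δ / 3)) + ENNReal.ofReal (δ / 3) :=
        add_le_add (add_le_add E1 E2) E3'
    _ = ENNReal.ofReal δ := by
        rw [← ENNReal.ofReal_add hδ3.le hδ3.le, ← ENNReal.ofReal_add (by positivity) hδ3.le]
        congr 1
        ring

/-- **NEC-ps: `(A) → ESO-ps → T34p-ps` — the necessity of the kinetic core in the pre-shock, data-tied frame.**  Under the marginal
envelope (A) of the evolved local Gibbs law, the TIED crux statistic ESO-ps (verbatim the strategist's `CollisionRatePreShock`: for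
classical hard-sphere Euler solutions on `[0,T)` with packing below the threshold and local Gibbs data satisfying the `t = 0` LLN, for
horizons `τ < T`, `evenStat σ N (Φ N) τ χ g 1 r` is small in `LG`-probability) implies the TIED kinetic core T34p-ps
(`evenTubeTimeStat σ N (Φ N) τ χ g Ξ₁ᴸ r κ` small in `LG`-probability, same frame).  Proof = NEC `stub_evenTubeTimeStatProb_of_evenStatOne`
with the tied binders threaded; union bound on `T = D − (D − D_L) − (D_L − T)`, accuracies `(η/3, δ/3)`, `L₀ := max L₀(T1) 1`,
`κ₀ := κ₀(T2)`. [folklore] -/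
theorem stub_evenTubeTimeStatProbPreShock_of_evenStatOnePreShock :
    (∀ (a₀ θ₀ : T3 → ℝ) (u₀ : T3 → V3), Continuous a₀ → Continuous θ₀ → Continuous u₀ →
      (∀ x, 0 < a₀ x) → (∀ x, 0 < θ₀ x) → ∃ σ₀ : ℝ, 0 < σ₀ ∧ ∀ σ : ℝ, 0 < σ → σ < σ₀ →
      ∀ Φ : (N : ℕ) → HardSphereFlow (Torus.geometry (Fin 3)) (hsDiameter σ N) (N + 1),
      ∀ τ : ℝ, 0 < τ → ∃ C : ℝ, 0 ≤ C ∧ ∃ u : V3, ∃ θ : ℝ, 0 < θ ∧ ∃ N₀ : ℕ, ∀ N : ℕ, N₀ ≤ N →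
      ∀ t ∈ Set.Icc (0 : ℝ) τ,
        (∀ i j : Fin (N + 1), i ≠ j → ∀ f : (T3 × V3) × (T3 × V3) → ℝ≥0∞, Measurable f →
          ∫⁻ z, f ((Φ N).flow t z i, (Φ N).flow t z j) ∂(localGibbsLaw σ a₀ u₀ θ₀ N (Φ N)) ≤
            ENNReal.ofReal C * ∫⁻ q, f q ∂(((volume : Measure T3).prod (gaussMeasure u θ)).prod
              ((volume : Measure T3).prod (gaussMeasure u θ)))) ∧
        (∀ i j k : Fin (N + 1), i ≠ j → i ≠ k → j ≠ k → ∀ f : (T3 × V3) × (T3 × V3) × (T3 × V3) → ℝ≥0∞, Measurable f →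
          ∫⁻ z, f ((Φ N).flow t z i, (Φ N).flow t z j, (Φ N).flow t z k) ∂(localGibbsLaw σ a₀ u₀ θ₀ N (Φ N)) ≤
            ENNReal.ofReal C * ∫⁻ q, f q ∂(((volume : Measure T3).prod (gaussMeasure u θ)).prod
              (((volume : Measure T3).prod (gaussMeasure u θ)).prod ((volume : Measure T3).prod (gaussMeasure u θ)))))) →
    (∃ η₀ : ℝ, 0 < η₀ ∧ ∀ (a₀ θ₀ : T3 → ℝ) (u₀ : T3 → V3), Continuous a₀ → Continuous θ₀ → Continuous u₀ →
      (∀ x, 0 < a₀ x) → (∀ x, 0 < θ₀ x) → ∃ σ₀ : ℝ, 0 < σ₀ ∧ ∀ σ : ℝ, 0 < σ → σ < σ₀ →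
      ∀ (T : ℝ) (ρ θ : ℝ → T3 → ℝ) (u : ℝ → T3 → V3), IsHardSphereEulerSolution σ T ρ u θ →
      (∀ t ∈ Set.Ico 0 T, ∀ x, ρ t x * σ ^ 3 < η₀) →
      ∀ Φ : (N : ℕ) → HardSphereFlow (Torus.geometry (Fin 3)) (hsDiameter σ N) (N + 1),
      TendstoHydroFieldsAt (fun N => localGibbsLaw σ a₀ u₀ θ₀ N (Φ N)) Φ ρ u θ 0 →
      ∀ τ : ℝ, 0 < τ → τ < T → ∀ χ : ℝ × T3 → ℝ, Continuous χ → ∀ g : ℝ → ℝ, Continuous g →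
      (∀ a, η₀ ≤ a → g a = 0) →
      ∀ η δ : ℝ, 0 < η → 0 < δ → ∃ r₀ : ℝ, 0 < r₀ ∧ ∀ r : ℝ, 0 < r → r < r₀ →
      ∃ N₀ : ℕ, ∀ N : ℕ, N₀ ≤ N →
        localGibbsLaw σ a₀ u₀ θ₀ N (Φ N) {z | η < |evenStat σ N (Φ N) τ χ g (fun _ => 1) r z|}
          ≤ ENNReal.ofReal δ) →
    ∃ η₀ : ℝ, 0 < η₀ ∧ ∀ (a₀ θ₀ : T3 → ℝ) (u₀ : T3 → V3), Continuous a₀ → Continuous θ₀ → Continuous u₀ →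
      (∀ x, 0 < a₀ x) → (∀ x, 0 < θ₀ x) → ∃ σ₀ : ℝ, 0 < σ₀ ∧ ∀ σ : ℝ, 0 < σ → σ < σ₀ →
      ∀ (T : ℝ) (ρ θ : ℝ → T3 → ℝ) (u : ℝ → T3 → V3), IsHardSphereEulerSolution σ T ρ u θ →
      (∀ t ∈ Set.Ico 0 T, ∀ x, ρ t x * σ ^ 3 < η₀) →
      ∀ Φ : (N : ℕ) → HardSphereFlow (Torus.geometry (Fin 3)) (hsDiameter σ N) (N + 1),
      TendstoHydroFieldsAt (fun N => localGibbsLaw σ a₀ u₀ θ₀ N (Φ N)) Φ ρ u θ 0 →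
      ∀ τ : ℝ, 0 < τ → τ < T → ∀ χ : ℝ × T3 → ℝ, Continuous χ → ∀ g : ℝ → ℝ, Continuous g →
      (∀ x, η₀ ≤ x → g x = 0) →
      ∀ η δ : ℝ, 0 < η → 0 < δ → ∃ r₀ : ℝ, 0 < r₀ ∧ ∀ r : ℝ, 0 < r → r < r₀ →
      ∃ L₀ : ℝ, ∀ L : ℝ, L₀ ≤ L → ∃ κ₀ : ℝ, 0 < κ₀ ∧ ∀ κ : ℝ, 0 < κ → κ < κ₀ → ∃ N₀ : ℕ, ∀ N : ℕ, N₀ ≤ N →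
        localGibbsLaw σ a₀ u₀ θ₀ N (Φ N)
          {z | η < |evenTubeTimeStat σ N (Φ N) τ χ g (fun q : V3 × V3 × V3 => speedCutoff L ‖q.2.2 - q.2.1‖) r κ z|}
          ≤ ENNReal.ofReal δ := by
  -- adapted from `stub_evenTubeTimeStatProb_of_evenStatOne` (NEC): the same chain, the tied binders threaded to the crux summand
  intro hA hC
  -- the landed links of the chain (frame-free)
  have hF2 := stub_collisionMarkFluxLG_of_envelope hA
  have hF3 := stub_fwdHitFluxLG_of_envelope hA
  have hCMB : CollisionMomentBound :=
    Summit.AtomisticToContinuum.HydrodynamicLimit.Theorems.CollisionMomentBound.collisionMomentBound_of_collisionMarkFlux hF2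
  have hT2b := stub_shortFlightDeficitLG_of_flux hF2 hF3
  have hT2 := stub_cylinderPullbackUnit_of_residuals (stub_continuityCorrectionLG hCMB hT2b) hT2b
    (stub_threeBodyCollisionSumLG_of_envelope hA)
  obtain ⟨η₁, hη₁, H1⟩ := stub_unitMarkTruncation hCMB
  obtain ⟨η₂, hη₂, H2⟩ := hT2
  obtain ⟨ηc, hηc, HC⟩ := hC
  refine ⟨min (min η₁ η₂) ηc, lt_min (lt_min hη₁ hη₂) hηc, ?_⟩
  intro a₀ θ₀ u₀ ha hθ hu ha0 hθ0
  obtain ⟨σ₁, hσ₁, H1⟩ := H1 a₀ θ₀ u₀ ha hθ hu ha0 hθ0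
  obtain ⟨σ₂, hσ₂, H2⟩ := H2 a₀ θ₀ u₀ ha hθ hu ha0 hθ0
  obtain ⟨σc, hσc, HC⟩ := HC a₀ θ₀ u₀ ha hθ hu ha0 hθ0
  refine ⟨min (min σ₁ σ₂) σc, lt_min (lt_min hσ₁ hσ₂) hσc, ?_⟩
  intro σ hσ hσlt T ρ θ u hEul hguard Φ hLLN τ hτ hτT χ hχ g hg hg0 η δ hη hδ
  have hσ1 : σ < σ₁ := lt_of_lt_of_le hσlt ((min_le_left _ _).trans (min_le_left _ _))
  have hσ2 : σ < σ₂ := lt_of_lt_of_le hσlt ((min_le_left _ _).trans (min_le_right _ _))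
  have hσc' : σ < σc := lt_of_lt_of_le hσlt (min_le_right _ _)
  -- the cutoff vanishes above each threshold
  have hg1 : ∀ x, η₁ ≤ x → g x = 0 := fun x h => hg0 x (((min_le_left _ _).trans (min_le_left _ _)).trans h)
  have hg2 : ∀ x, η₂ ≤ x → g x = 0 := fun x h => hg0 x (((min_le_left _ _).trans (min_le_right _ _)).trans h)
  have hgc : ∀ a, ηc ≤ a → g a = 0 := fun a h => hg0 a ((min_le_right _ _).trans h)
  -- the packing guard at the composite threshold implies the guard at `ηc`
  have hguardc : ∀ t ∈ Set.Ico 0 T, ∀ x, ρ t x * σ ^ 3 < ηc :=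
    fun t ht x => lt_of_lt_of_le (hguard t ht x) (min_le_right _ _)
  -- accuracies
  have hη3 : 0 < η / 3 := by positivity
  have hδ3 : 0 < δ / 3 := by positivity
  obtain ⟨r₁, hr₁, H1⟩ := H1 σ hσ hσ1 Φ τ hτ χ hχ g hg hg1 (η / 3) (δ / 3) hη3 hδ3
  obtain ⟨r₂, hr₂, H2⟩ := H2 σ hσ hσ2 Φ τ hτ χ hχ g hg hg2 (η / 3) (δ / 3) hη3 hδ3
  obtain ⟨rc, hrc, HC⟩ :=
    HC σ hσ hσc' T ρ θ u hEul hguardc Φ hLLN τ hτ hτT χ hχ g hg hgc (η / 3) (δ / 3) hη3 hδ3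
  refine ⟨min (min r₁ r₂) rc, lt_min (lt_min hr₁ hr₂) hrc, ?_⟩
  intro r hr hrlt
  have hr1 : r < r₁ := lt_of_lt_of_le hrlt ((min_le_left _ _).trans (min_le_left _ _))
  have hr2 : r < r₂ := lt_of_lt_of_le hrlt ((min_le_left _ _).trans (min_le_right _ _))
  have hrc' : r < rc := lt_of_lt_of_le hrlt (min_le_right _ _)
  -- truncation level (T1) and the crux statistic (ESO-ps) at this `r`
  obtain ⟨L₀, H1⟩ := H1 r hr hr1
  obtain ⟨Nc, HC⟩ := HC r hr hrc'
  refine ⟨max L₀ 1, fun L hL => ?_⟩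
  have hL0 : L₀ ≤ L := (le_max_left _ _).trans hL
  have hL1 : (1 : ℝ) ≤ L := (le_max_right _ _).trans hL
  obtain ⟨N₁, H1⟩ := H1 L hL0
  -- flight-time window (T2)
  obtain ⟨κ₂, hκ₂, H2⟩ := H2 r hr hr2 L hL1
  refine ⟨κ₂, hκ₂, fun κ hκ hκlt => ?_⟩
  obtain ⟨N₂, H2⟩ := H2 κ hκ hκlt
  refine ⟨max N₁ (max N₂ Nc), fun N hN => ?_⟩
  have hN1 : N₁ ≤ N := (le_max_left _ _).trans hN
  have hN2 : N₂ ≤ N := ((le_max_left _ _).trans (le_max_right _ _)).trans hN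
  have hNc : Nc ≤ N := ((le_max_right _ _).trans (le_max_right _ _)).trans hN
  have E1 := H1 N hN1
  have E2 := H2 N hN2
  have EC := HC N hNc
  -- the union bound
  set P := localGibbsLaw σ a₀ u₀ θ₀ N (Φ N) with hP
  set D := fun z => evenStat σ N (Φ N) τ χ g (fun _ => 1) r z with hD
  set DL := fun z => evenStat σ N (Φ N) τ χ g (fun q : V3 × V3 × V3 => speedCutoff L ‖q.2.2 - q.2.1‖) r z with hDL
  set T' := fun z => evenTubeTimeStat σ N (Φ N) τ χ g (fun q : V3 × V3 × V3 => speedCutoff L ‖q.2.2 - q.2.1‖) r κ z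
    with hT'
  have hsub : {z | η < |T' z|} ⊆
      ({z | η / 3 < |D z - DL z|} ∪ {z | η / 3 < |DL z - T' z|}) ∪ {z | η / 3 < |D z|} := by
    intro z hz
    simp only [Set.mem_setOf_eq, Set.mem_union] at hz ⊢
    by_contra hcon
    simp only [not_or, not_lt] at hcon
    obtain ⟨⟨h1, h2⟩, h3⟩ := hcon
    have i1 : |DL z| - |D z| ≤ |D z - DL z| := by
      rw [abs_sub_comm (D z) (DL z)]
      exact abs_sub_abs_le_abs_sub (DL z) (D z)
    have i2 : |T' z| - |DL z| ≤ |DL z - T' z| := by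
      rw [abs_sub_comm (DL z) (T' z)]
      exact abs_sub_abs_le_abs_sub (T' z) (DL z)
    linarith
  calc P {z | η < |T' z|}
      ≤ P (({z | η / 3 < |D z - DL z|} ∪ {z | η / 3 < |DL z - T' z|}) ∪ {z | η / 3 < |D z|}) :=
        measure_mono hsub
    _ ≤ P ({z | η / 3 < |D z - DL z|} ∪ {z | η / 3 < |DL z - T' z|}) + P {z | η / 3 < |D z|} :=
        measure_union_le _ _
    _ ≤ (P {z | η / 3 < |D z - DL z|} + P {z | η / 3 < |DL z - T' z|}) + P {z | η / 3 < |D z|} :=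
        add_le_add (measure_union_le _ _) le_rfl
    _ ≤ (ENNReal.ofReal (δ / 3) + ENNReal.ofReal (δ / 3)) + ENNReal.ofReal (δ / 3) :=
        add_le_add (add_le_add E1 E2) EC
    _ = ENNReal.ofReal δ := by
        rw [← ENNReal.ofReal_add hδ3.le hδ3.le, ← ENNReal.ofReal_add (by positivity) hδ3.le]
        congr 1
        ring

end

end Summit.AtomisticToContinuum.HydrodynamicLimit.Theorems.CollisionRate
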